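import Summits.Ventures.HSemireg.WedgeHankelSiegelIdealStable

/-!
# Venture HSemireg — THE SIEGEL IDEAL (8): FN-4 (i)'s KERNEL CLAUSE in th-6's OWN typing — for `FormulaN.wedgeWith k q` / `FormulaN.vClass q`
# the `q`-independent kernel is the (transported) Siegel ideal, `dim = C(2n,k) − (k+1)·C(n,k)`, `dim ker(wedgeWith k q)` obeys the excess law; `⋀^k ∧ Siegel_n = SI_{k+2}`

HONEST FRAMING. Part of the Lean index of the computation cell `pub-hsemireg` (seat p10 gen 11, Sunday typer «UNIFORM-IN-n»).
Finite-dimensional EXTERIOR ALGEBRA over a field ONLY; no variety, no cohomology theory, no sheaf, no Ext group, no semiregularity map;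
nothing here says that HC / HC_CM / HC_AV holds; no Literature fact is declared or used.  Custodian versions as in `WedgeHankelSiegelIdeal`
(1/3): th-6's typed statements `FormulaNStatement` (`vClass`, `wedgeWith`, `hankel`, `HankelLawAt`, `FN4_classLevel`) and FORMULA-N PART A
§2.6 FN-4 (i) VERBATIM: «rank(⌟v ∣ HT^k(X)) = C(n,k)·rank H_k(v), with v-independent kernel the Θ-isotropic part (on HT²: the Siegel space
S²_Θ)».  The RANK clause is th-7's THEOREM H, glued to th-6's typing in `WedgeHankelGlue.hankelLawAt`; the KERNEL clause had no typed form.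
The dictionary is QUOTED, never asserted.

THIS FILE (continues namespace `Summit.Ventures.HSemireg.Wedge.HankelSiegelIdeal`; imports (4) `…Stable`; transports along th-7's reindexing
algebra isomorphism `Φ : FormulaN.HT ≃ₐ HT (In n)`, `∂_a ↦ x_a`, `dz̄_a ↦ y_a`, `Φ (vClass q) = w_n(q)`):
* §13 `finrank_exteriorPower_N` (`dim ⋀^k N = C(2n,k)`); `finrank_ker_wedgeWith_eq`; **THE EXCESS LAW IN th-6's TYPING `finrank_ker_wedgeWith`:
  `dim ker(wedgeWith k q) = dim SI_k + C(n,k)·(k + 1 − rank (hankel k q))`** (`k ≤ n`, every field, every `q`);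
* **THE Θ-ISOTROPIC PART IN th-6's MODEL** `siegelIdealFN n k := Φ⁻¹(SI_k)`; **`mem_siegelIdealFN_iff`: for `θ ∈ ⋀^k N`, `θ ∈ siegelIdealFN ⟺
  θ ∧ vClass q = 0` for EVERY `q`** (the KERNEL CLAUSE of FN-4 (i), every field, `n`, `k`); `mem_siegelIdealFN_iff_elemClass` (⟺ killed by the
  `n + 1` classes `elemClass p = E_p`, `p ≤ n`); **`finrank_siegelIdealFN`: `dim + (k+1)·C(n,k) = C(2n,k)`**; **`iInf_ker_wedgeWith_eq`:
  `⋂_q ker(wedgeWith k q)` = the isotropic part**; `x_mul_y_add_mem_siegelIdealFN`: th-6's symmetric 2-vectors `∂_a∧dz̄_b + ∂_b∧dz̄_a`,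
  `∂_a∧dz̄_a` lie in it (degree `2`: it IS their span, the Siegel space, by (1/3)'s `siegelIdeal_two` transported — dimension `n(n+1)/2`).
* §14 STRUCTURAL COMPLEMENTS (th-7 side): `siegelIdeal_zero` / `siegelIdeal_one` (`SI_0 = SI_1 = 0`); **`exteriorPower_mul_siegel`:
  `⋀^k ∧ Siegel_n = SI_{k+2}` as a SUBMODULE PRODUCT in the exterior algebra** (so `SI_k` is literally the degree-`k` multiples of the Siegel space,
  not only by the definition as a span); `B_mul_mem_siegelIdeal` / `mul_B_mem_siegelIdeal` / **`exteriorPower_mul_siegelIdeal_le`: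
  `⋀^j ∧ SI_k ⊆ SI_{j+k}` and `SI_k ∧ ⋀^j ⊆ SI_{k+j}`** — `⊕_k SI_k` is a two-sided ideal (the Siegel 2-vectors are even).
NOT typed: a th-6-side generating family in degree `k > 2` spelled in `∂`/`dz̄` letters (it is `Φ⁻¹` of the `E_t ∧ s_{ab}`); anything Ext-side.  Class side only.
-/

open Module

namespace Summit.Ventures.HSemireg.Wedge.HankelSiegelIdeal

open Summit.Ventures.HSemireg.Wedge Summit.Ventures.HSemireg.Wedge.Hankel
  Summit.Ventures.HSemireg.Wedge.HankelSiegel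

variable (K : Type*) [Field K] {n : ℕ}

/-! ## §13. FN-4 (i)'s kernel clause in th-6's OWN typing (`FormulaN.wedgeWith`, `FormulaN.vClass`), along th-7's reindexing `Φ` -/

/-- `dim ⋀^k N = C(2n, k)` in th-6's model (`N = K^{Fin n ⊕ Fin n}`). -/
lemma finrank_exteriorPower_N (k : ℕ) : finrank K (⋀[K]^k (FormulaN.N K n)) = (n + n).choose k := by
  rw [exteriorPower.finrank_eq, finrank_fintype_fun_eq_card, Fintype.card_sum, Fintype.card_fin]

/-- th-6's `wedgeWith k q` and th-7's `wedge k (w_n(q))` have kernels of the same dimension (`k ≤ n`; both ranges are `C(n,k)·rank H_k(q)`). -/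
lemma finrank_ker_wedgeWith_eq {k : ℕ} (hk : k ≤ n) (q : ℕ → K) :
    finrank K (LinearMap.ker (FormulaN.wedgeWith K n k q)) = finrank K (LinearMap.ker (Hankel.wedge K n k (w K n n q))) := by
  have h1 := LinearMap.finrank_range_add_finrank_ker (FormulaN.wedgeWith K n k q)
  have h2 := LinearMap.finrank_range_add_finrank_ker (Hankel.wedge K n k (w K n n q))
  have h3 : finrank K (LinearMap.range (FormulaN.wedgeWith K n k q)) = n.choose k * (FormulaN.hankel K n k q).rank :=
    hankelLawAt K n hk q
  rw [finrank_exteriorPower_N, h3, rank_hankel_eq K n hk] at h1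
  rw [finrank_exteriorPower, hankelLaw_model] at h2
  omega

/-- **FN-4 (i)'s KERNEL CLAUSE, th-6's typing — THE EXCESS LAW for `wedgeWith`: `dim ker(wedgeWith k q) = dim SI_k + C(n,k)·(k + 1 − rank hankel k q)`**
(`k ≤ n`, every field, every `q`; `SI_k` = the degree-`k` Siegel ideal, of dimension `C(2n,k) − (k+1)·C(n,k)`). -/
theorem finrank_ker_wedgeWith {k : ℕ} (hk : k ≤ n) (q : ℕ → K) :
    finrank K (LinearMap.ker (FormulaN.wedgeWith K n k q)) =
      finrank K (siegelIdeal K n k) + n.choose k * (k + 1 - (FormulaN.hankel K n k q).rank) := by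
  rw [finrank_ker_wedgeWith_eq K hk, finrank_ker_wedge_w, rank_hankel_eq K n hk]

/-- **THE Θ-ISOTROPIC PART IN th-6's MODEL**: the preimage of the degree-`k` Siegel ideal under th-7's reindexing `Φ` (`∂_a ↦ x_a`, `dz̄_a ↦ y_a`). -/
noncomputable def siegelIdealFN (n k : ℕ) : Submodule K (FormulaN.HT K n) := (siegelIdeal K n k).comap (Φ K n).toLinearMap

/-- `Φ` maps `⋀^k N` into `⋀^k`. -/
lemma Φ_mem_exteriorPower {k : ℕ} {θ : FormulaN.HT K n} (hθ : θ ∈ ⋀[K]^k (FormulaN.N K n)) : Φ K n θ ∈ ⋀[K]^k (In n → K) := by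
  rw [← map_Φ_exteriorPower]; exact ⟨θ, hθ, rfl⟩

/-- **FN-4 (i), KERNEL CLAUSE («with v-independent kernel the Θ-isotropic part»), th-6's typing: a `k`-form `θ ∈ ⋀^k N` lies in the isotropic
part iff `θ ∧ vClass q = 0` for EVERY coefficient sequence `q`** — every field, `n`, `k`. -/
theorem mem_siegelIdealFN_iff {k : ℕ} {θ : FormulaN.HT K n} (hθ : θ ∈ ⋀[K]^k (FormulaN.N K n)) :
    θ ∈ siegelIdealFN K n k ↔ ∀ q : ℕ → K, θ * FormulaN.vClass K n q = 0 := by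
  rw [siegelIdealFN, Submodule.mem_comap, AlgEquiv.toLinearMap_apply, mem_siegelIdeal_iff_forall_mul_w' K (Φ_mem_exteriorPower K hθ)]
  constructor
  · intro h q
    have h1 := h q
    rw [← Φ_vClass, ← map_mul] at h1
    exact (map_eq_zero_iff _ (Φ K n).injective).mp h1
  · intro h q
    rw [← Φ_vClass, ← map_mul, h q, map_zero]

/-- equivalently: killed by the `n + 1` classes `E_p = elemClass p` (`Θ^p/p!`), `p ≤ n`. -/
theorem mem_siegelIdealFN_iff_elemClass {k : ℕ} {θ : FormulaN.HT K n} (hθ : θ ∈ ⋀[K]^k (FormulaN.N K n)) :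
    θ ∈ siegelIdealFN K n k ↔ ∀ p, p ≤ n → θ * FormulaN.elemClass K n p = 0 := by
  have hE : ∀ p, p ≤ n → FormulaN.elemClass K n p = FormulaN.vClass K n (fun j => if j = p then (1 : K) else 0) := by
    intro p hp
    rw [FormulaN.vClass, Finset.sum_eq_single p]
    · rw [if_pos rfl, one_smul]
    · intro m _ hmp; rw [if_neg hmp, zero_smul]
    · intro hp'; exact absurd (Finset.mem_range.mpr (by omega)) hp'
  rw [siegelIdealFN, Submodule.mem_comap, AlgEquiv.toLinearMap_apply, mem_siegelIdeal_iff_forall_spike K (Φ_mem_exteriorPower K hθ)]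
  constructor
  · intro h p hp
    have h1 := h p hp
    rw [← Φ_vClass, ← map_mul, ← hE p hp] at h1
    exact (map_eq_zero_iff _ (Φ K n).injective).mp h1
  · intro h p hp
    rw [← Φ_vClass, ← hE p hp, ← map_mul, h p hp, map_zero]

/-- **its dimension: `dim + (k+1)·C(n,k) = C(2n,k)`** (transport of `finrank_siegelIdeal` along the equivalence `Φ`). -/
theorem finrank_siegelIdealFN (k : ℕ) : finrank K (siegelIdealFN K n k) + (k + 1) * n.choose k = (n + n).choose k := by
  have h : siegelIdealFN K n k = (siegelIdeal K n k).map (Φ K n).symm.toLinearEquiv.toLinearMap := by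
    rw [siegelIdealFN]
    exact Submodule.comap_equiv_eq_map_symm (Φ K n).toLinearEquiv (siegelIdeal K n k)
  rw [h, LinearEquiv.finrank_map_eq]
  exact finrank_siegelIdeal K k

/-- **`⋂_q ker(wedgeWith k q)` = the isotropic part (inside `⋀^k N`)**, th-6's typing, every field, `n`, `k`. -/
theorem iInf_ker_wedgeWith_eq (k : ℕ) :
    (⨅ q : ℕ → K, LinearMap.ker (FormulaN.wedgeWith K n k q)) = (siegelIdealFN K n k).comap (⋀[K]^k (FormulaN.N K n)).subtype := by
  ext ⟨θ, hθ⟩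
  rw [Submodule.mem_iInf, Submodule.mem_comap, Submodule.subtype_apply, mem_siegelIdealFN_iff K hθ]
  simp only [LinearMap.mem_ker, FormulaN.wedgeWith, LinearMap.comp_apply, Submodule.subtype_apply, LinearMap.mulRight_apply]

/-- the isotropic part contains th-6's symmetric 2-vectors `∂_a ∧ dz̄_b + ∂_b ∧ dz̄_a` (and `∂_a ∧ dz̄_a`): `Φ` of them is `s_{ab}`. -/
theorem x_mul_y_add_mem_siegelIdealFN (a c : Fin n) :
    FormulaN.x K n a * FormulaN.y K n c + (if a = c then 0 else FormulaN.x K n c * FormulaN.y K n a) ∈ siegelIdealFN K n 2 := by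
  rw [siegelIdealFN, Submodule.mem_comap, AlgEquiv.toLinearMap_apply]
  have h : Φ K n (FormulaN.x K n a * FormulaN.y K n c + (if a = c then 0 else FormulaN.x K n c * FormulaN.y K n a)) = sv K (n := n) a c := by
    rw [sv, map_add, map_mul, Φ_x, Φ_y, ← X_fin, ← Y_fin]
    split_ifs with h1 h2 h2
    · rw [map_zero]
    · exact absurd (congrArg Fin.val h1) h2
    · exact absurd (Fin.ext h2) h1
    · rw [map_mul, Φ_x, Φ_y, ← X_fin, ← Y_fin]
  rw [h]
  have hm := B_mul_sv_mem K (n := n) (t := ∅) (k := 2) (by simp) a c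
  rwa [B_empty, one_mul] at hm


/-! ## §14. Structural complements: `SI_k` is the degree-`k` part of the two-sided ideal generated by the Siegel space -/

/-- no Siegel multiples in degree `0`. -/
theorem siegelIdeal_zero : siegelIdeal K n 0 = ⊥ := by
  rw [siegelIdeal, Submodule.span_eq_bot]
  rintro _ ⟨⟨⟨t, ht⟩, _⟩, rfl⟩
  omega

/-- no Siegel multiples in degree `1`. -/
theorem siegelIdeal_one : siegelIdeal K n 1 = ⊥ := by
  rw [siegelIdeal, Submodule.span_eq_bot]
  rintro _ ⟨⟨⟨t, ht⟩, _⟩, rfl⟩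
  omega

/-- **`⋀^k ∧ Siegel_n = SI_{k+2}`** (submodule product in the exterior algebra): the degree-`k+2` Siegel ideal IS the degree-`k` multiples of the Siegel space. -/
theorem exteriorPower_mul_siegel (k : ℕ) : (⋀[K]^k (In n → K)) * siegel K n = siegelIdeal K n (k + 2) := by
  rw [exteriorPower_eq_Hom_univ, Hom, siegel, Submodule.span_mul_span, siegelIdeal]
  congr 1
  ext x
  constructor
  · rintro ⟨_, ⟨t, ⟨-, ht⟩, rfl⟩, _, ⟨p, rfl⟩, rfl⟩
    exact ⟨(⟨t, by rw [ht]⟩, p), rfl⟩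
  · rintro ⟨⟨⟨t, ht⟩, p⟩, rfl⟩
    exact ⟨_, ⟨t, ⟨Finset.subset_univ _, by omega⟩, rfl⟩, _, ⟨p, rfl⟩, rfl⟩

/-- **left ideal: `E_s ∧ SI_k ⊆ SI_{|s| + k}`.** -/
theorem B_mul_mem_siegelIdeal {k : ℕ} {θ : HT K (In n)} (hθ : θ ∈ siegelIdeal K n k) (s : Finset (In n)) :
    B K (In n) s * θ ∈ siegelIdeal K n (s.card + k) := by
  induction hθ using Submodule.span_induction with
  | mem x hx =>
    obtain ⟨⟨⟨t, ht⟩, p⟩, rfl⟩ := hx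
    rw [igen, ← mul_assoc, B_mul_B, smul_mul_assoc]
    by_cases hst : Disjoint s t
    · exact Submodule.smul_mem _ _ (Submodule.subset_span ⟨(⟨s ∪ t, by rw [Finset.card_union_of_disjoint hst]; omega⟩, p), rfl⟩)
    · rw [u_eq_zero K hst, zero_smul]; exact Submodule.zero_mem _
  | zero => rw [mul_zero]; exact Submodule.zero_mem _
  | add x y _ _ hx hy => rw [mul_add]; exact Submodule.add_mem _ hx hy
  | smul c x _ hx => rw [mul_smul_comm]; exact Submodule.smul_mem _ _ hx

/-- **right ideal: `SI_k ∧ E_s ⊆ SI_{k + |s|}`** (the Siegel 2-vectors are even, so they commute past `E_s`). -/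
theorem mul_B_mem_siegelIdeal {k : ℕ} {θ : HT K (In n)} (hθ : θ ∈ siegelIdeal K n k) (s : Finset (In n)) :
    θ * B K (In n) s ∈ siegelIdeal K n (k + s.card) := by
  induction hθ using Submodule.span_induction with
  | mem x hx =>
    obtain ⟨⟨⟨t, ht⟩, p⟩, rfl⟩ := hx
    rw [igen, mul_assoc, sgen, mul_comm_of_mem_Hom_two K (sv_mem_Hom_two K _ _) (B_mem_Hom K (Finset.subset_univ s) rfl), ← mul_assoc,
      B_mul_B, smul_mul_assoc]
    by_cases hts : Disjoint t s
    · exact Submodule.smul_mem _ _ (Submodule.subset_span ⟨(⟨t ∪ s, by rw [Finset.card_union_of_disjoint hts]; omega⟩, p), rfl⟩)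
    · rw [u_eq_zero K hts, zero_smul]; exact Submodule.zero_mem _
  | zero => rw [zero_mul]; exact Submodule.zero_mem _
  | add x y _ _ hx hy => rw [add_mul]; exact Submodule.add_mem _ hx hy
  | smul c x _ hx => rw [smul_mul_assoc]; exact Submodule.smul_mem _ _ hx

/-- **two-sided ideal, submodule form: `⋀^j ∧ SI_k ⊆ SI_{j+k}` and `SI_k ∧ ⋀^j ⊆ SI_{k+j}`.** -/
theorem exteriorPower_mul_siegelIdeal_le (j k : ℕ) :
    (⋀[K]^j (In n → K)) * siegelIdeal K n k ≤ siegelIdeal K n (j + k) ∧ siegelIdeal K n k * (⋀[K]^j (In n → K)) ≤ siegelIdeal K n (k + j) := by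
  constructor
  · rw [exteriorPower_eq_Hom_univ, Hom, Submodule.mul_le]
    intro η hη θ hθ
    induction hη using Submodule.span_induction with
    | mem x hx => obtain ⟨s, ⟨-, hs⟩, rfl⟩ := hx; rw [← hs]; exact B_mul_mem_siegelIdeal K hθ s
    | zero => rw [zero_mul]; exact Submodule.zero_mem _
    | add x y _ _ hx hy => rw [add_mul]; exact Submodule.add_mem _ hx hy
    | smul c x _ hx => rw [smul_mul_assoc]; exact Submodule.smul_mem _ _ hx
  · rw [exteriorPower_eq_Hom_univ, Hom, Submodule.mul_le]
    intro θ hθ η hη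
    induction hη using Submodule.span_induction with
    | mem x hx => obtain ⟨s, ⟨-, hs⟩, rfl⟩ := hx; rw [← hs]; exact mul_B_mem_siegelIdeal K hθ s
    | zero => rw [mul_zero]; exact Submodule.zero_mem _
    | add x y _ _ hx hy => rw [mul_add]; exact Submodule.add_mem _ hx hy
    | smul c x _ hx => rw [mul_smul_comm]; exact Submodule.smul_mem _ _ hx


end Summit.Ventures.HSemireg.Wedge.HankelSiegelIdeal
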